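import Literature.Analysis.FluidPDE.NSBootstrapDefs
import HarnessLib

/-!
# The Serrin bootstrap: Leibniz expansions of the represented derivatives of the fluxes

Analysis/FluidPDE proofs file (theorems only). In the induction on the number of space
derivatives for bounded distributional Navier–Stokes solutions (Lemarié-Rieusset 2016, Thm. 13.1;
Seregin–Šverák 2009, §2 p. 8) the flux of the weak vorticity equation is quadratic,
`⟪spinFlux_{bc}, eᵢ⟫ = -δ_{ic} Σ_l u_l A_{bl} + δ_{ib} Σ_l u_l A_{cl}`, and its derivatives of
order `≤ n` are represented by the Leibniz sums `prodRep` / `fluxRep` of `NSBootstrapDefs` as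
soon as the derivatives of `u_b`, `A_{bc}` of order `≤ n` are represented and those of order
`< n` are essentially bounded (`isRepDeriv_prodRep`, `isRepDeriv_fluxRep`; the step is the weak
product rule `RepDeriv.IsRepDeriv.mul`). The file also records the first-order identity between
consecutive representatives (`IsRepDeriv.firstOrder_of_cons`), the differentiated base identities
at each level (`heat_identity_level`, `poisson_identity_level`), the essential bounds of the
Leibniz sums below the top order and their `L^m` bounds at the top order.

## References

* P. G. Lemarié-Rieusset, *The Navier–Stokes Problem in the 21st Century* (2016), Thm. 13.1,
  Step 2. [`LemarieRieusset2016`]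
* G. Seregin, V. Šverák, Comm. PDE 34 (2009) = arXiv:0804.1803, §2 p. 8. [`SereginSverak2009`]
-/

noncomputable section

open MeasureTheory Set Function Filter Topology TopologicalSpace Metric
open scoped NNReal ENNReal RealInnerProductSpace Laplacian

namespace Literature.Analysis.FluidPDE

namespace NSBootstrap

open RepDeriv

/-! ### Generic facts on represented derivatives -/

section Generic

variable {E : Type*} [NormedAddCommGroup E] [InnerProductSpace ℝ E] [FiniteDimensional ℝ E]
  [MeasurableSpace E] [BorelSpace E]
variable {Q : Opens (ℝ × E)}

/-- **Consecutive representatives**: if `f` represents `∂^{vs}h` and `f'` represents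
`∂^{v :: vs}h`, then `f'` represents `∂ᵥ f`. [folklore] -/
theorem _root_.Literature.Analysis.FluidPDE.RepDeriv.IsRepDeriv.firstOrder_of_cons {h f f' : ℝ × E → ℝ} {vs : List E} {v : E}
    (hf : IsRepDeriv Q h vs f) (hf' : IsRepDeriv Q h (v :: vs) f') : IsRepDeriv Q f [v] f' := by
  refine ⟨hf.2.1, hf'.2.1, fun ψ hψ => ?_⟩
  have h1 := hf.integral_eq (NSSpinHeat.isSpaceTimeTestOn_fderiv_apply hψ v)
  have h2 := hf'.integral_eq hψ
  rw [derivs_cons] at h2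
  rw [h1, List.length_cons, pow_succ] at h2
  have hne : ((-1 : ℝ) ^ vs.length) ≠ 0 := pow_ne_zero _ (by norm_num)
  rw [derivs_singleton, List.length_singleton, pow_one]
  have : (-1 : ℝ) ^ vs.length * ∫ q : ℝ × E, f q * fderiv ℝ (ψ q.1) q.2 v =
      (-1 : ℝ) ^ vs.length * (-1 * ∫ q : ℝ × E, f' q * ψ q.1 q.2) := by rw [h2]; ring
  exact mul_left_cancel₀ hne this

/-- Sums over a list of represented derivatives. [folklore] -/
theorem isRepDeriv_listSum {ι : Type*} {hs fs : ι → ℝ × E → ℝ} {vs : List E} (l : List ι)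
    (h : ∀ i ∈ l, IsRepDeriv Q (hs i) vs (fs i)) (h0 : l ≠ [] ∨ True) :
    l ≠ [] → IsRepDeriv Q (fun q => (l.map fun i => hs i q).sum) vs (fun q => (l.map fun i => fs i q).sum) := by
  intro hl
  induction l with
  | nil => exact absurd rfl hl
  | cons a l ih =>
    by_cases hl' : l = []
    · subst hl'
      have := h a (by simp)
      simpa using this
    · have iha := ih (fun i hi => h i (List.mem_cons_of_mem a hi)) (Or.inl hl') hl'
      have ha := h a (by simp)
      have := ha.add iha
      simpa [List.map_cons, List.sum_cons] using this

/-- Finite sums of represented derivatives over `Fin 3`. [folklore] -/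
theorem isRepDeriv_sum_fin3 {hs fs : Fin 3 → ℝ × E → ℝ} {vs : List E}
    (h : ∀ i, IsRepDeriv Q (hs i) vs (fs i)) :
    IsRepDeriv Q (fun q => ∑ i, hs i q) vs (fun q => ∑ i, fs i q) := by
  have := ((h 0).add (h 1)).add (h 2)
  simpa [Fin.sum_univ_three, add_assoc] using this

/-- Negation of a represented derivative. [folklore] -/
theorem _root_.Literature.Analysis.FluidPDE.RepDeriv.IsRepDeriv.neg' {h f : ℝ × E → ℝ} {vs : List E} (hf : IsRepDeriv Q h vs f) :
    IsRepDeriv Q (fun q => -h q) vs (fun q => -f q) := by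
  simpa using hf.const_mul (-1)

end Generic

/-! ### The Leibniz expansions represent the derivatives of the products -/

section Leibniz

variable {u : ℝ → EuclideanSpace ℝ (Fin 3) → EuclideanSpace ℝ (Fin 3)}
  {G : ℝ → EuclideanSpace ℝ (Fin 3) → EuclideanSpace ℝ (Fin 3) →L[ℝ] EuclideanSpace ℝ (Fin 3)}
  {U : List (Fin 3) → Fin 3 → ℝ × EuclideanSpace ℝ (Fin 3) → ℝ}
  {A : List (Fin 3) → Fin 3 → Fin 3 → ℝ × EuclideanSpace ℝ (Fin 3) → ℝ}
  {Q : Opens (ℝ × EuclideanSpace ℝ (Fin 3))} {n : ℕ} {K : ℝ≥0}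

/-- Local integrability passes to a.e. modifications on the open set. [folklore] -/
theorem locallyIntegrableOn_congr_ae {f g : ℝ × EuclideanSpace ℝ (Fin 3) → ℝ}
    (hf : LocallyIntegrableOn f (Q : Set (ℝ × EuclideanSpace ℝ (Fin 3))) volume)
    (hfg : ∀ᵐ q ∂(volume : Measure (ℝ × EuclideanSpace ℝ (Fin 3))), q ∈ (Q : Set _) → f q = g q) :
    LocallyIntegrableOn g (Q : Set (ℝ × EuclideanSpace ℝ (Fin 3))) volume := by
  refine (locallyIntegrableOn_iff Q.isOpen.isLocallyClosed).2 fun C hCQ hCc => ?_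
  refine (hf.integrableOn_compact_subset hCQ hCc).congr_fun_ae ?_
  rw [EventuallyEq, ae_restrict_iff' hCc.measurableSet]
  filter_upwards [hfg] with q hq hqC
  exact hq (hCQ hqC)

/-- `prodRep` at a successor multi-index, as a sum over the splittings of the tail. [folklore] -/
theorem prodRep_cons (i : Fin 3) (γ : List (Fin 3)) (l b l' : Fin 3) (q : ℝ × EuclideanSpace ℝ (Fin 3)) :
    prodRep U A (i :: γ) l b l' q =
      ((splits γ).map fun s => U (i :: s.1) l q * A s.2 b l' q + U s.1 l q * A (i :: s.2) b l' q).sum := by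
  rw [prodRep, splits_cons]
  induction splits γ with
  | nil => simp
  | cons s L ih =>
    simp only [List.flatMap_cons, List.map_append, List.map_cons, List.map_nil, List.sum_append,
      List.sum_cons, List.sum_nil, add_zero] at ih ⊢
    rw [ih]

/-- `prodRep` as a sum over the splittings (function form). [folklore] -/
theorem prodRep_eq (γ : List (Fin 3)) (l b l' : Fin 3) :
    prodRep U A γ l b l' = fun q => ((splits γ).map fun s => U s.1 l q * A s.2 b l' q).sum := rfl

/-- **The Leibniz sums represent the derivatives of the products.** If the derivatives of
`u_l` and `A_{bc}` of order `≤ n` are represented on `Q` by `U`, `A`, those of order `< n`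
are essentially bounded on `Q` by `K`, and the products `u_l A_{bl'}` are locally integrable on
`Q`, then for every multi-index `γ` of length `≤ n` the sum `prodRep U A γ l b l'` represents
`∂^γ(u_l A_{bl'})` on `Q` (induction on `γ`; the step is the weak product rule
`IsRepDeriv.mul`). [folklore] -/
theorem isRepDeriv_prodRep
    (hrepU : ∀ α : List (Fin 3), α.length ≤ n → ∀ l,
      IsRepDeriv Q (fun q => u q.1 q.2 l) (α.map frame) (U α l))
    (hrepA : ∀ α : List (Fin 3), α.length ≤ n → ∀ b c,
      IsRepDeriv Q (spinEntry G b c) (α.map frame) (A α b c))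
    (hbdU : ∀ α : List (Fin 3), α.length + 1 ≤ n → ∀ l,
      ∀ᵐ q ∂(volume : Measure (ℝ × EuclideanSpace ℝ (Fin 3))), q ∈ (Q : Set _) → |U α l q| ≤ K)
    (hbdA : ∀ α : List (Fin 3), α.length + 1 ≤ n → ∀ b c,
      ∀ᵐ q ∂(volume : Measure (ℝ × EuclideanSpace ℝ (Fin 3))), q ∈ (Q : Set _) → |A α b c q| ≤ K)
    (hbase : ∀ l b l', LocallyIntegrableOn (fun q => u q.1 q.2 l * spinEntry G b l' q) (Q : Set _) volume) :
    ∀ γ : List (Fin 3), γ.length ≤ n → ∀ l b l',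
      IsRepDeriv Q (fun q => u q.1 q.2 l * spinEntry G b l' q) (γ.map frame) (prodRep U A γ l b l') := by
  intro γ
  induction γ with
  | nil =>
    intro _ l b l'
    have hU := hrepU [] (by simp) l
    have hA := hrepA [] (by simp) b l'
    simp only [List.map_nil] at hU hA ⊢
    have eU := (isRepDeriv_nil hU.1).ae_eq hU
    have eA := (isRepDeriv_nil hA.1).ae_eq hA
    have hbase' := hbase l b l'
    have hae : ∀ᵐ q ∂(volume : Measure (ℝ × EuclideanSpace ℝ (Fin 3))), q ∈ (Q : Set _) →
        u q.1 q.2 l * spinEntry G b l' q = prodRep U A [] l b l' q := by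
      filter_upwards [eU, eA] with q hqU hqA hqQ
      rw [prodRep_nil, hqU hqQ, hqA hqQ]
    exact (isRepDeriv_nil hbase').congr_ae (locallyIntegrableOn_congr_ae hbase' hae) hae
  | cons i γ ih =>
    intro hlen l b l'
    have hγn : γ.length + 1 ≤ n := by simpa using hlen
    have ihγ := ih (by omega) l b l'
    -- the product rule for every splitting of `γ`
    have hterm : ∀ s ∈ splits γ,
        IsRepDeriv Q (fun q => U s.1 l q * A s.2 b l' q) [frame i]
          (fun q => U (i :: s.1) l q * A s.2 b l' q + U s.1 l q * A (i :: s.2) b l' q) := by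
      intro s hs
      have hsl := length_add_of_mem_splits hs
      have h1 : s.1.length + 1 ≤ n := by omega
      have h2 : s.2.length + 1 ≤ n := by omega
      have hf := hrepU s.1 (by omega) l
      have hk := hrepA s.2 (by omega) b l'
      have hf' := hrepU (i :: s.1) (by simpa using h1) l
      have hk' := hrepA (i :: s.2) (by simpa using h2) b l'
      rw [List.map_cons] at hf' hk'
      exact IsRepDeriv.mul K.coe_nonneg hf.locallyIntegrableOn.aestronglyMeasurable
        hk.locallyIntegrableOn.aestronglyMeasurable (hbdU s.1 h1 l) (hbdA s.2 h2 b l')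
        (hf.firstOrder_of_cons hf') (hk.firstOrder_of_cons hk')
    -- sum over the splittings
    have hne : splits γ ≠ [] := by
      intro h
      have := length_splits γ
      rw [h, List.length_nil] at this
      exact absurd this.symm (pow_ne_zero _ (by norm_num))
    have hsum := isRepDeriv_listSum (Q := Q) (vs := [frame i]) (splits γ)
      (hs := fun s q => U s.1 l q * A s.2 b l' q)
      (fs := fun s q => U (i :: s.1) l q * A s.2 b l' q + U s.1 l q * A (i :: s.2) b l' q)
      hterm (Or.inr trivial) hne
    have e1 : (fun q => ((splits γ).map fun s => U s.1 l q * A s.2 b l' q).sum) = prodRep U A γ l b l' :=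
      (prodRep_eq γ l b l').symm
    have e2 : (fun q => ((splits γ).map fun s =>
        U (i :: s.1) l q * A s.2 b l' q + U s.1 l q * A (i :: s.2) b l' q).sum) =
        prodRep U A (i :: γ) l b l' := by
      funext q; rw [prodRep_cons]
    rw [e1, e2] at hsum
    -- the step
    rw [List.map_cons]
    refine ihγ.cons hsum.locallyIntegrableOn fun ψ hψ => ?_
    have h := hsum.integral_eq hψ
    simpa [derivs_singleton] using h

/-- **The flux components are represented by `fluxRep`.** Under the hypotheses of
`isRepDeriv_prodRep`, for `|γ| ≤ n` the function `fluxRep U A γ b c i` represents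
`∂^γ ⟪spinFlux u G b c, eᵢ⟫` on `Q`. [folklore] -/
theorem isRepDeriv_fluxRep
    (hrepU : ∀ α : List (Fin 3), α.length ≤ n → ∀ l,
      IsRepDeriv Q (fun q => u q.1 q.2 l) (α.map frame) (U α l))
    (hrepA : ∀ α : List (Fin 3), α.length ≤ n → ∀ b c,
      IsRepDeriv Q (spinEntry G b c) (α.map frame) (A α b c))
    (hbdU : ∀ α : List (Fin 3), α.length + 1 ≤ n → ∀ l,
      ∀ᵐ q ∂(volume : Measure (ℝ × EuclideanSpace ℝ (Fin 3))), q ∈ (Q : Set _) → |U α l q| ≤ K)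
    (hbdA : ∀ α : List (Fin 3), α.length + 1 ≤ n → ∀ b c,
      ∀ᵐ q ∂(volume : Measure (ℝ × EuclideanSpace ℝ (Fin 3))), q ∈ (Q : Set _) → |A α b c q| ≤ K)
    (hbase : ∀ l b l', LocallyIntegrableOn (fun q => u q.1 q.2 l * spinEntry G b l' q) (Q : Set _) volume)
    {γ : List (Fin 3)} (hγ : γ.length ≤ n) (b c i : Fin 3) :
    IsRepDeriv Q (fun q => ⟪spinFlux u G b c q, frame i⟫) (γ.map frame) (fluxRep U A γ b c i) := by
  have hP := isRepDeriv_prodRep hrepU hrepA hbdU hbdA hbase γ hγ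
  have h1 : IsRepDeriv Q (fun q => ∑ l, u q.1 q.2 l * spinEntry G b l q) (γ.map frame)
      (fun q => ∑ l, prodRep U A γ l b l q) := isRepDeriv_sum_fin3 fun l => hP l b l
  have h2 : IsRepDeriv Q (fun q => ∑ l, u q.1 q.2 l * spinEntry G c l q) (γ.map frame)
      (fun q => ∑ l, prodRep U A γ l c l q) := isRepDeriv_sum_fin3 fun l => hP l c l
  have h := ((h1.const_mul ⟪(frame c : EuclideanSpace ℝ (Fin 3)), frame i⟫).neg').add
    (h2.const_mul ⟪(frame b : EuclideanSpace ℝ (Fin 3)), frame i⟫)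
  have eL : (fun q => -(⟪(frame c : EuclideanSpace ℝ (Fin 3)), frame i⟫ * ∑ l, u q.1 q.2 l * spinEntry G b l q) +
      ⟪(frame b : EuclideanSpace ℝ (Fin 3)), frame i⟫ * ∑ l, u q.1 q.2 l * spinEntry G c l q) =
      fun q => ⟪spinFlux u G b c q, frame i⟫ := by
    funext q; rw [inner_spinFlux_frame]
  have eR : (fun q => -(⟪(frame c : EuclideanSpace ℝ (Fin 3)), frame i⟫ * ∑ l, prodRep U A γ l b l q) +
      ⟪(frame b : EuclideanSpace ℝ (Fin 3)), frame i⟫ * ∑ l, prodRep U A γ l c l q) = fluxRep U A γ b c i := by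
    funext q; rfl
  rw [eL, eR] at h
  exact h

end Leibniz


/-! ### Combinatorics of the splittings -/

section Splits

/-- In a splitting of `γ`, the first part is `γ` itself unless it is strictly shorter; and then
the second part is empty. [folklore] -/
theorem fst_eq_of_mem_splits {γ : List (Fin 3)} {s : List (Fin 3) × List (Fin 3)}
    (hs : s ∈ splits γ) (hl : s.1.length = γ.length) : s = (γ, []) := by
  induction γ generalizing s with
  | nil =>
    simp only [splits_nil, List.mem_singleton] at hs
    exact hs
  | cons i γ ih =>
    simp only [splits_cons, List.mem_flatMap, List.mem_cons, List.mem_nil_iff, or_false] at hs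
    obtain ⟨s', hs', h | h⟩ := hs
    · subst h
      simp only [List.length_cons, add_left_inj] at hl
      have := ih hs' hl
      subst this
      rfl
    · subst h
      have h1 := length_add_of_mem_splits hs'
      simp only [List.length_cons] at hl
      omega

/-- In a splitting of `γ`, the second part is `γ` itself unless it is strictly shorter; and
then the first part is empty. [folklore] -/
theorem snd_eq_of_mem_splits {γ : List (Fin 3)} {s : List (Fin 3) × List (Fin 3)}
    (hs : s ∈ splits γ) (hl : s.2.length = γ.length) : s = ([], γ) := by
  induction γ generalizing s with
  | nil =>
    simp only [splits_nil, List.mem_singleton] at hs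
    exact hs
  | cons i γ ih =>
    simp only [splits_cons, List.mem_flatMap, List.mem_cons, List.mem_nil_iff, or_false] at hs
    obtain ⟨s', hs', h | h⟩ := hs
    · subst h
      have h1 := length_add_of_mem_splits hs'
      simp only [List.length_cons] at hl
      omega
    · subst h
      simp only [List.length_cons, add_left_inj] at hl
      have := ih hs' hl
      subst this
      rfl

end Splits

/-! ### Bounds of the Leibniz sums -/

section Bounds

variable {α' : Type*} [MeasurableSpace α']

/-- Triangle inequality for `|Σ|` over a list. [folklore] -/
theorem abs_list_sum_map_le {ι : Type*} (l : List ι) (f : ι → ℝ) :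
    |(l.map f).sum| ≤ (l.map fun i => |f i|).sum := by
  induction l with
  | nil => simp
  | cons a l ih =>
    simp only [List.map_cons, List.sum_cons]
    exact (abs_add_le _ _).trans (add_le_add le_rfl ih)

/-- Measurability of list sums of the form `x ↦ Σ_{i ∈ l} f i x`. [folklore] -/
theorem aestronglyMeasurable_list_sum_map {ι : Type*} {μ : Measure α'} (l : List ι)
    {f : ι → α' → ℝ} (hf : ∀ i ∈ l, AEStronglyMeasurable (f i) μ) :
    AEStronglyMeasurable (fun x => (l.map fun i => f i x).sum) μ := by
  have h := (l.map f).aestronglyMeasurable_fun_sum (fun g hg => by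
    obtain ⟨i, hi, rfl⟩ := List.mem_map.1 hg
    exact hf i hi)
  have e : (fun x => ((l.map f).map fun g : α' → ℝ => g x).sum) = fun x => (l.map fun i => f i x).sum := by
    funext x; rw [List.map_map]; rfl
  rw [e] at h
  exact h

/-- Triangle inequality for `eLpNorm` over a list (`1 ≤ m`). [folklore] -/
theorem eLpNorm_list_sum_map_le {ι : Type*} {μ : Measure α'} {m : ℝ≥0∞} (hm : 1 ≤ m) (l : List ι)
    {f : ι → α' → ℝ} (hf : ∀ i ∈ l, AEStronglyMeasurable (f i) μ) :
    eLpNorm (fun x => (l.map fun i => f i x).sum) m μ ≤ (l.map fun i => eLpNorm (f i) m μ).sum := by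
  induction l with
  | nil => simp
  | cons a l ih =>
    have hfa := hf a (by simp)
    have hfl : ∀ i ∈ l, AEStronglyMeasurable (f i) μ := fun i hi => hf i (List.mem_cons_of_mem a hi)
    have hmeas := aestronglyMeasurable_list_sum_map l hfl
    simp only [List.map_cons, List.sum_cons]
    exact (eLpNorm_add_le hfa hmeas hm).trans (add_le_add le_rfl (ih hfl))

/-- A list sum of constants. [folklore] -/
theorem list_sum_map_const {ι β : Type*} [AddCommMonoid β] (l : List ι) (b : β) :
    (l.map fun _ => b).sum = l.length • b := by
  rw [List.map_const', List.sum_replicate]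

variable {U : List (Fin 3) → Fin 3 → ℝ × EuclideanSpace ℝ (Fin 3) → ℝ}
  {A : List (Fin 3) → Fin 3 → Fin 3 → ℝ × EuclideanSpace ℝ (Fin 3) → ℝ}
  {S : Set (ℝ × EuclideanSpace ℝ (Fin 3))} {n : ℕ} {K : ℝ≥0}

/-- **Essential bound of the Leibniz sums below the top order**: if all `U α l`, `A α b c` with
`|α| ≤ n` are essentially bounded by `K` on `S`, then `|prodRep U A γ l b l'| ≤ 2^{|γ|} K²` a.e.
on `S` for `|γ| ≤ n`. [folklore] -/
theorem ae_abs_prodRep_le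
    (hbdU : ∀ α : List (Fin 3), α.length ≤ n → ∀ l, ∀ᵐ q ∂(volume.restrict S), |U α l q| ≤ K)
    (hbdA : ∀ α : List (Fin 3), α.length ≤ n → ∀ b c, ∀ᵐ q ∂(volume.restrict S), |A α b c q| ≤ K)
    {γ : List (Fin 3)} (hγ : γ.length ≤ n) (l b l' : Fin 3) :
    ∀ᵐ q ∂(volume.restrict S), |prodRep U A γ l b l' q| ≤ 2 ^ γ.length * (K : ℝ) ^ 2 := by
  have hU' : ∀ᵐ q ∂(volume.restrict S), ∀ α : List (Fin 3), ∀ l, α.length ≤ n → |U α l q| ≤ K := by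
    refine ae_all_iff.2 fun α => ae_all_iff.2 fun l => ?_
    by_cases h : α.length ≤ n
    · exact (hbdU α h l).mono fun q hq _ => hq
    · exact Eventually.of_forall fun q h' => absurd h' h
  have hA' : ∀ᵐ q ∂(volume.restrict S), ∀ α : List (Fin 3), ∀ b c, α.length ≤ n → |A α b c q| ≤ K := by
    refine ae_all_iff.2 fun α => ae_all_iff.2 fun b => ae_all_iff.2 fun c => ?_
    by_cases h : α.length ≤ n
    · exact (hbdA α h b c).mono fun q hq _ => hq
    · exact Eventually.of_forall fun q h' => absurd h' h
  filter_upwards [hU', hA'] with q hqU hqA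
  rw [prodRep]
  refine (abs_list_sum_map_le _ _).trans ?_
  have hterm : ∀ s ∈ splits γ, |U s.1 l q * A s.2 b l' q| ≤ (K : ℝ) ^ 2 := by
    intro s hs
    have hsl := length_add_of_mem_splits hs
    rw [abs_mul, sq]
    exact mul_le_mul (hqU s.1 l (by omega)) (hqA s.2 b l' (by omega)) (abs_nonneg _) K.coe_nonneg
  calc ((splits γ).map fun s => |U s.1 l q * A s.2 b l' q|).sum
      ≤ ((splits γ).map fun _ => (K : ℝ) ^ 2).sum := List.sum_le_sum fun s hs => hterm s hs
    _ = 2 ^ γ.length * (K : ℝ) ^ 2 := by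
        rw [list_sum_map_const, length_splits, nsmul_eq_mul]
        push_cast
        ring

/-- Measurability of the Leibniz sums. [folklore] -/
theorem aestronglyMeasurable_prodRep {μ : Measure (ℝ × EuclideanSpace ℝ (Fin 3))}
    (hU : ∀ α : List (Fin 3), α.length ≤ n → ∀ l, AEStronglyMeasurable (U α l) μ)
    (hA : ∀ α : List (Fin 3), α.length ≤ n → ∀ b c, AEStronglyMeasurable (A α b c) μ)
    {γ : List (Fin 3)} (hγ : γ.length ≤ n) (l b l' : Fin 3) :
    AEStronglyMeasurable (prodRep U A γ l b l') μ := by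
  rw [prodRep_eq]
  exact aestronglyMeasurable_list_sum_map _ fun s hs => by
    have := length_add_of_mem_splits hs
    exact (hU s.1 (by omega) l).mul (hA s.2 (by omega) b l')

/-- Measurability of the flux representatives. [folklore] -/
theorem aestronglyMeasurable_fluxRep {μ : Measure (ℝ × EuclideanSpace ℝ (Fin 3))}
    (hU : ∀ α : List (Fin 3), α.length ≤ n → ∀ l, AEStronglyMeasurable (U α l) μ)
    (hA : ∀ α : List (Fin 3), α.length ≤ n → ∀ b c, AEStronglyMeasurable (A α b c) μ)
    {γ : List (Fin 3)} (hγ : γ.length ≤ n) (b c i : Fin 3) :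
    AEStronglyMeasurable (fluxRep U A γ b c i) μ := by
  have h1 : AEStronglyMeasurable (fun q => ∑ l, prodRep U A γ l b l q) μ :=
    Finset.aestronglyMeasurable_fun_sum _ fun l _ => aestronglyMeasurable_prodRep hU hA hγ l b l
  have h2 : AEStronglyMeasurable (fun q => ∑ l, prodRep U A γ l c l q) μ :=
    Finset.aestronglyMeasurable_fun_sum _ fun l _ => aestronglyMeasurable_prodRep hU hA hγ l c l
  exact ((aestronglyMeasurable_const.mul h1).neg).add (aestronglyMeasurable_const.mul h2)

/-- **`L^m` bound of the Leibniz sums at the top order.** If all `U α l`, `A α b c` with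
`|α| ≤ n` are essentially bounded by `K` on the measurable set `S` of finite measure and all the
functions are measurable there, then for `|γ| = n`, `1 ≤ m`:
`‖prodRep U A (i :: γ) l b l'‖_{L^m(S)} ≤ 2ⁿ (K (‖U (i :: γ) l‖_{L^m(S)} + ‖A (i :: γ) b l'‖_{L^m(S)}) + 2 K² |S|^{1/m})`.
[folklore] -/
theorem eLpNorm_prodRep_cons_le {m : ℝ≥0∞} (hm : 1 ≤ m)
    (hU : ∀ α : List (Fin 3), α.length ≤ n + 1 → ∀ l, AEStronglyMeasurable (U α l) (volume.restrict S))
    (hA : ∀ α : List (Fin 3), α.length ≤ n + 1 → ∀ b c, AEStronglyMeasurable (A α b c) (volume.restrict S))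
    (hbdU : ∀ α : List (Fin 3), α.length ≤ n → ∀ l, ∀ᵐ q ∂(volume.restrict S), |U α l q| ≤ K)
    (hbdA : ∀ α : List (Fin 3), α.length ≤ n → ∀ b c, ∀ᵐ q ∂(volume.restrict S), |A α b c q| ≤ K)
    {γ : List (Fin 3)} (hγ : γ.length = n) (i l b l' : Fin 3) :
    eLpNorm (prodRep U A (i :: γ) l b l') m (volume.restrict S) ≤
      2 ^ n * ((K : ℝ≥0∞) * (eLpNorm (U (i :: γ) l) m (volume.restrict S) +
        eLpNorm (A (i :: γ) b l') m (volume.restrict S)) +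
        2 * (K : ℝ≥0∞) * K * (volume S) ^ m.toReal⁻¹) := by
  set μ : Measure (ℝ × EuclideanSpace ℝ (Fin 3)) := volume.restrict S with hμ
  set NU : ℝ≥0∞ := eLpNorm (U (i :: γ) l) m μ with hNU
  set NA : ℝ≥0∞ := eLpNorm (A (i :: γ) b l') m μ with hNA
  set V : ℝ≥0∞ := (volume S) ^ m.toReal⁻¹ with hV
  have hVμ : μ univ ^ m.toReal⁻¹ = V := by rw [hμ, Measure.restrict_apply_univ]
  -- the bound of a bounded factor times anything, and of a product of two bounded factors
  have hbb : ∀ {f g : ℝ × EuclideanSpace ℝ (Fin 3) → ℝ}, (∀ᵐ q ∂μ, |f q| ≤ K) → (∀ᵐ q ∂μ, |g q| ≤ K) →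
      eLpNorm (fun q => f q * g q) m μ ≤ (K : ℝ≥0∞) * K * V := by
    intro f g hf hg
    have h : ∀ᵐ q ∂μ, ‖f q * g q‖ ≤ ((K * K : ℝ≥0) : ℝ) := by
      filter_upwards [hf, hg] with q hqf hqg
      rw [norm_mul, Real.norm_eq_abs, Real.norm_eq_abs, NNReal.coe_mul]
      exact mul_le_mul hqf hqg (abs_nonneg _) K.coe_nonneg
    have := eLpNorm_le_of_ae_bound (p := m) h
    rw [hVμ, ENNReal.ofReal_coe_nnreal, ENNReal.coe_mul] at this
    calc eLpNorm (fun q => f q * g q) m μ ≤ V * (K * K) := this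
      _ = K * K * V := by ring
  have hbx : ∀ {f g : ℝ × EuclideanSpace ℝ (Fin 3) → ℝ}, (∀ᵐ q ∂μ, |g q| ≤ K) →
      eLpNorm (fun q => f q * g q) m μ ≤ (K : ℝ≥0∞) * eLpNorm f m μ := by
    intro f g hg
    have h : ∀ᵐ q ∂μ, ‖f q * g q‖ ≤ (K : ℝ) * ‖f q‖ := by
      filter_upwards [hg] with q hq
      rw [norm_mul, Real.norm_eq_abs, Real.norm_eq_abs, mul_comm]
      exact mul_le_mul_of_nonneg_right hq (abs_nonneg _)
    have := eLpNorm_le_mul_eLpNorm_of_ae_le_mul h m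
    rwa [ENNReal.ofReal_coe_nnreal] at this
  have hxb : ∀ {f g : ℝ × EuclideanSpace ℝ (Fin 3) → ℝ}, (∀ᵐ q ∂μ, |f q| ≤ K) →
      eLpNorm (fun q => f q * g q) m μ ≤ (K : ℝ≥0∞) * eLpNorm g m μ := by
    intro f g hf
    have e : (fun q => f q * g q) = fun q => g q * f q := by funext q; ring
    rw [e]; exact hbx hf
  -- each splitting contributes at most `K (NU + NA) + 2 K² V`
  have hterm : ∀ s ∈ splits γ,
      eLpNorm (fun q => U (i :: s.1) l q * A s.2 b l' q + U s.1 l q * A (i :: s.2) b l' q) m μ ≤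
        (K : ℝ≥0∞) * (NU + NA) + 2 * (K : ℝ≥0∞) * K * V := by
    intro s hs
    have hsl := length_add_of_mem_splits hs
    have hm1 : AEStronglyMeasurable (fun q => U (i :: s.1) l q * A s.2 b l' q) μ :=
      (hU _ (by simp only [List.length_cons]; omega) l).mul (hA _ (by omega) b l')
    have hm2 : AEStronglyMeasurable (fun q => U s.1 l q * A (i :: s.2) b l' q) μ :=
      (hU _ (by omega) l).mul (hA _ (by simp only [List.length_cons]; omega) b l')
    refine (eLpNorm_add_le hm1 hm2 hm).trans ?_
    have hA2 : ∀ᵐ q ∂μ, |A s.2 b l' q| ≤ K := hbdA s.2 (by omega) b l'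
    have hU1 : ∀ᵐ q ∂μ, |U s.1 l q| ≤ K := hbdU s.1 (by omega) l
    -- first summand
    have h1 : eLpNorm (fun q => U (i :: s.1) l q * A s.2 b l' q) m μ ≤ (K : ℝ≥0∞) * NU + K * K * V := by
      by_cases hfull : s.1.length = γ.length
      · have := fst_eq_of_mem_splits hs hfull
        subst this
        exact (hbx hA2).trans le_self_add
      · have hlt : (i :: s.1).length ≤ n := by simp only [List.length_cons]; omega
        exact (hbb (hbdU _ hlt l) hA2).trans le_add_self
    -- second summand
    have h2 : eLpNorm (fun q => U s.1 l q * A (i :: s.2) b l' q) m μ ≤ (K : ℝ≥0∞) * NA + K * K * V := by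
      by_cases hfull : s.2.length = γ.length
      · have := snd_eq_of_mem_splits hs hfull
        subst this
        exact (hxb hU1).trans le_self_add
      · have hlt : (i :: s.2).length ≤ n := by simp only [List.length_cons]; omega
        exact (hbb hU1 (hbdA _ hlt b l')).trans le_add_self
    calc eLpNorm (fun q => U (i :: s.1) l q * A s.2 b l' q) m μ +
          eLpNorm (fun q => U s.1 l q * A (i :: s.2) b l' q) m μ
        ≤ ((K : ℝ≥0∞) * NU + K * K * V) + ((K : ℝ≥0∞) * NA + K * K * V) := add_le_add h1 h2
      _ = (K : ℝ≥0∞) * (NU + NA) + 2 * (K : ℝ≥0∞) * K * V := by ring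
  -- sum over the splittings
  have e : prodRep U A (i :: γ) l b l' = fun q => ((splits γ).map fun s =>
      U (i :: s.1) l q * A s.2 b l' q + U s.1 l q * A (i :: s.2) b l' q).sum := by
    funext q; rw [prodRep_cons]
  rw [e]
  refine (eLpNorm_list_sum_map_le hm (splits γ) fun s hs => ?_).trans ?_
  · have hsl := length_add_of_mem_splits hs
    exact ((hU _ (by simp only [List.length_cons]; omega) l).mul (hA _ (by omega) b l')).add
      ((hU _ (by omega) l).mul (hA _ (by simp only [List.length_cons]; omega) b l'))
  calc ((splits γ).map fun s => eLpNorm (fun q =>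
        U (i :: s.1) l q * A s.2 b l' q + U s.1 l q * A (i :: s.2) b l' q) m μ).sum
      ≤ ((splits γ).map fun _ => (K : ℝ≥0∞) * (NU + NA) + 2 * (K : ℝ≥0∞) * K * V).sum :=
        List.sum_le_sum hterm
    _ = 2 ^ n * ((K : ℝ≥0∞) * (NU + NA) + 2 * (K : ℝ≥0∞) * K * V) := by
        rw [list_sum_map_const, length_splits, hγ, nsmul_eq_mul]
        push_cast
        ring

end Bounds


/-! ### The base identities at every level -/

section Identities

variable {u : ℝ → EuclideanSpace ℝ (Fin 3) → EuclideanSpace ℝ (Fin 3)}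
  {G : ℝ → EuclideanSpace ℝ (Fin 3) → EuclideanSpace ℝ (Fin 3) →L[ℝ] EuclideanSpace ℝ (Fin 3)}
  {U : List (Fin 3) → Fin 3 → ℝ × EuclideanSpace ℝ (Fin 3) → ℝ}
  {A : List (Fin 3) → Fin 3 → Fin 3 → ℝ × EuclideanSpace ℝ (Fin 3) → ℝ}
  {L ρ : ℝ} {n : ℕ} {K : ℝ≥0}

/-- **The first-order identity between consecutive representatives**:
`∫ U γ b ∂ᵢψ = -∫ U (i :: γ) b ψ`. [folklore] -/
theorem firstOrder_level
    (hrepU : ∀ α : List (Fin 3), α.length ≤ n + 1 → ∀ l,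
      IsRepDeriv (cylOpens L ρ) (fun q => u q.1 q.2 l) (α.map frame) (U α l))
    {γ : List (Fin 3)} (hγ : γ.length ≤ n) (i b : Fin 3) {ψ : ℝ → EuclideanSpace ℝ (Fin 3) → ℝ}
    (hψ : IsSpaceTimeTestOn (cylOpens L ρ) ψ) :
    ∫ q : ℝ × EuclideanSpace ℝ (Fin 3), U γ b q * fderiv ℝ (ψ q.1) q.2 (frame i) =
      -∫ q : ℝ × EuclideanSpace ℝ (Fin 3), U (i :: γ) b q * ψ q.1 q.2 := by
  have h1 := hrepU γ (by omega) b
  have h2 := hrepU (i :: γ) (by simpa using Nat.succ_le_succ hγ) b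
  rw [List.map_cons] at h2
  have h := (h1.firstOrder_of_cons h2).integral_eq hψ
  simpa [derivs_singleton] using h

/-- The same for the representatives of the spin entries. [folklore] -/
theorem firstOrder_level_A
    (hrepA : ∀ α : List (Fin 3), α.length ≤ n + 1 → ∀ b c,
      IsRepDeriv (cylOpens L ρ) (spinEntry G b c) (α.map frame) (A α b c))
    {γ : List (Fin 3)} (hγ : γ.length ≤ n) (i b c : Fin 3) {ψ : ℝ → EuclideanSpace ℝ (Fin 3) → ℝ}
    (hψ : IsSpaceTimeTestOn (cylOpens L ρ) ψ) :
    ∫ q : ℝ × EuclideanSpace ℝ (Fin 3), A γ b c q * fderiv ℝ (ψ q.1) q.2 (frame i) =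
      -∫ q : ℝ × EuclideanSpace ℝ (Fin 3), A (i :: γ) b c q * ψ q.1 q.2 := by
  have h1 := hrepA γ (by omega) b c
  have h2 := hrepA (i :: γ) (by simpa using Nat.succ_le_succ hγ) b c
  rw [List.map_cons] at h2
  have h := (h1.firstOrder_of_cons h2).integral_eq hψ
  simpa [derivs_singleton] using h

/-- **The weak heat equation at level `γ`**: `∫ (A γ b c)(∂ₜψ + Δψ) = Σᵢ ∫ (fluxRep U A γ b c i) ∂ᵢψ`
for all test functions on the cylinder (the base spin equation differentiated `|γ|` times,
`RepDeriv.IsRepDeriv.heat_identity`, with the Leibniz representatives of the flux). [folklore] -/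
theorem heat_identity_level (hheat : BaseHeat u G L ρ)
    (hrepU : ∀ α : List (Fin 3), α.length ≤ n → ∀ l,
      IsRepDeriv (cylOpens L ρ) (fun q => u q.1 q.2 l) (α.map frame) (U α l))
    (hrepA : ∀ α : List (Fin 3), α.length ≤ n → ∀ b c,
      IsRepDeriv (cylOpens L ρ) (spinEntry G b c) (α.map frame) (A α b c))
    (hbdU : ∀ α : List (Fin 3), α.length + 1 ≤ n → ∀ l,
      ∀ᵐ q ∂(volume : Measure (ℝ × EuclideanSpace ℝ (Fin 3))), q ∈ cyl L ρ → |U α l q| ≤ K)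
    (hbdA : ∀ α : List (Fin 3), α.length + 1 ≤ n → ∀ b c,
      ∀ᵐ q ∂(volume : Measure (ℝ × EuclideanSpace ℝ (Fin 3))), q ∈ cyl L ρ → |A α b c q| ≤ K)
    (hbase : ∀ l b l', LocallyIntegrableOn (fun q => u q.1 q.2 l * spinEntry G b l' q) (cyl L ρ) volume)
    (hflux : ∀ b c, LocallyIntegrableOn (spinFlux u G b c) (cyl L ρ) volume)
    {γ : List (Fin 3)} (hγ : γ.length ≤ n) (b c : Fin 3) {ψ : ℝ → EuclideanSpace ℝ (Fin 3) → ℝ}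
    (hψ : IsSpaceTimeTestOn (cylOpens L ρ) ψ) :
    ∫ q : ℝ × EuclideanSpace ℝ (Fin 3), A γ b c q * (timeDeriv ψ q.1 q.2 + (Δ (ψ q.1)) q.2) =
      ∑ i, ∫ q : ℝ × EuclideanSpace ℝ (Fin 3), fluxRep U A γ b c i q * fderiv ℝ (ψ q.1) q.2 (frame i) :=
  IsRepDeriv.heat_identity (Q := cylOpens L ρ) frame (hflux b c) (hheat b c) (hrepA γ hγ b c)
    (fun i => isRepDeriv_fluxRep (Q := cylOpens L ρ) hrepU hrepA hbdU hbdA hbase hγ b c i) hψ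

/-- The vector field with components the spin entries `A_{bc}`, `c = 0, 1, 2`. [folklore] -/
theorem inner_spinVec_frame (b c : Fin 3) (q : ℝ × EuclideanSpace ℝ (Fin 3)) :
    ⟪∑ c', spinEntry G b c' q • (frame c' : EuclideanSpace ℝ (Fin 3)), frame c⟫ = spinEntry G b c q := by
  classical
  rw [sum_inner]
  simp_rw [real_inner_smul_left, orthonormal_iff_ite.1 frame.orthonormal]
  simp

/-- **The very weak Poisson equation at level `γ`**: `∫ (U γ b) Δψ = -Σ_c ∫ (A γ b c) ∂_cψ` for
all test functions on the cylinder (the base Poisson equation differentiated `|γ|` times,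
`RepDeriv.IsRepDeriv.poisson_identity`). [folklore] -/
theorem poisson_identity_level (hpoi : BasePoisson u G L ρ)
    (hrepU : ∀ α : List (Fin 3), α.length ≤ n → ∀ l,
      IsRepDeriv (cylOpens L ρ) (fun q => u q.1 q.2 l) (α.map frame) (U α l))
    (hrepA : ∀ α : List (Fin 3), α.length ≤ n → ∀ b c,
      IsRepDeriv (cylOpens L ρ) (spinEntry G b c) (α.map frame) (A α b c))
    {γ : List (Fin 3)} (hγ : γ.length ≤ n) (b : Fin 3) {ψ : ℝ → EuclideanSpace ℝ (Fin 3) → ℝ}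
    (hψ : IsSpaceTimeTestOn (cylOpens L ρ) ψ) :
    ∫ q : ℝ × EuclideanSpace ℝ (Fin 3), U γ b q * (Δ (ψ q.1)) q.2 =
      -∑ c, ∫ q : ℝ × EuclideanSpace ℝ (Fin 3), A γ b c q * fderiv ℝ (ψ q.1) q.2 (frame c) := by
  set F : ℝ × EuclideanSpace ℝ (Fin 3) → EuclideanSpace ℝ (Fin 3) :=
    fun q => ∑ c', spinEntry G b c' q • (frame c' : EuclideanSpace ℝ (Fin 3)) with hF
  have hA0 : ∀ c, LocallyIntegrableOn (spinEntry G b c) (cyl L ρ) volume := fun c =>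
    (hrepA [] (by simp) b c).1
  have hFli : LocallyIntegrableOn F (cyl L ρ) volume := by
    refine (locallyIntegrableOn_iff (cylOpens L ρ).isOpen.isLocallyClosed).2 fun C hCQ hCc => ?_
    have : IntegrableOn F C volume :=
      integrable_finsetSum _ fun c' _ => ((hA0 c').integrableOn_compact_subset hCQ hCc).smul_const _
    exact this
  have hcomp : ∀ c, (fun q => ⟪F q, frame c⟫) = spinEntry G b c := fun c => by
    funext q; exact inner_spinVec_frame b c q
  -- the base identity in vector form
  have heq : ∀ ψ : ℝ → EuclideanSpace ℝ (Fin 3) → ℝ, IsSpaceTimeTestOn (cylOpens L ρ) ψ →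
      ∫ q : ℝ × EuclideanSpace ℝ (Fin 3), u q.1 q.2 b * (Δ (ψ q.1)) q.2 =
        -∫ q : ℝ × EuclideanSpace ℝ (Fin 3), ⟪F q, gradient (ψ q.1) q.2⟫ := by
    intro ψ hψ
    rw [hpoi b ψ hψ]
    congr 1
    have hint : ∀ c, Integrable (fun q : ℝ × EuclideanSpace ℝ (Fin 3) =>
        spinEntry G b c q * fderiv ℝ (ψ q.1) q.2 (frame c)) volume := fun c =>
      (isRepDeriv_nil (hA0 c)).integrable_mul' (NSSpinHeat.isSpaceTimeTestOn_fderiv_apply hψ (frame c))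
    rw [← integral_finsetSum _ fun c _ => hint c]
    refine integral_congr_ae (Eventually.of_forall fun q => ?_)
    dsimp only
    rw [inner_gradient_eq_sum_frame frame (F q) (ψ q.1) q.2]
    refine Finset.sum_congr rfl fun c _ => ?_
    rw [inner_spinVec_frame]
  have hΦ : ∀ c, IsRepDeriv (cylOpens L ρ) (fun q => ⟪F q, frame c⟫) (γ.map frame) (A γ b c) := by
    intro c; rw [hcomp c]; exact hrepA γ hγ b c
  exact IsRepDeriv.poisson_identity (Q := cylOpens L ρ) frame hFli heq (hrepU γ hγ b) hΦ hψ

end Identities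

end NSBootstrap

end Literature.Analysis.FluidPDE

end
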